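import Literature.Algebra.EuclideanLattices.MRIncGDDSuccess
import Literature.Probability.Distributions.IndepProductLawMeasure
import HarnessLib

/-!
# Micciancio–Regev 2007, proof of Thm. 5.9: the conditional success probability `≥ 1/3`, read at the `PMF` level — proved

Topic `Algebra/EuclideanLattices` (family `pqc`). Theorems only. Companion of `MRIncGDDSuccess.lean`,
which proves the last step of the proof of MR07 Thm. 5.9 (authors' version pp. 23–24: for independent
`yᵢ ∼ D_{Λ,s,cᵢ+tᵢ}`, `Pr[‖S‖/g + r < ‖s − t‖] ≤ 2/3`) for random variables on an abstract probability
space (`iIndepFun`, `HasLaw`). The fleet's machine layer for the named facts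
`Literature.Computability.Cryptography.MicciancioRegev2007_gapCVP'_to_SIS'` and
`Literature.Computability.Cryptography.owfExist_of_gapSVP_worstCaseHard` is `PMF`-based
(`RandAlg.outputPMF`, `indepLaw`); this file restates the two estimates for the product law
`⨂ᵢ D_{Λ,s,c'ᵢ} = indepLaw m (i ↦ discreteGaussian Λ s (c'ᵢ))` through the bridge
`IndepProductLawMeasure.lean` (`toMeasure_indepLaw = Measure.pi`, `iIndepFun_eval_indepLaw`,
`hasLaw_eval_indepLaw`):

* `MicciancioRegev2007.toReal_indepLaw_lt_norm_sum_smul_coe_sub_le` — the Markov step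
  (`Pr[r < ‖∑ zᵢ(yᵢ − c'ᵢ)‖] ≤ 2/3`);
* `MicciancioRegev2007.toReal_indepLaw_lt_norm_output_sub_le` — with the output `s = x − Yz`
  (`Pr[b + r < ‖s − t‖] ≤ 2/3` when `‖x − Cz‖ ≤ b`, `Tz = −t`).

## References

* D. Micciancio, O. Regev, *Worst-case to average-case reductions based on Gaussian measures*,
  SIAM J. Comput. 37 (2007) 267–302; authors' version (`lit read doi:10.1137/S0097539705447360`),
  Thm. 5.9 and its proof, pp. 23–24.
-/

noncomputable section

open scoped ENNReal
open MeasureTheory ProbabilityTheory Module Finset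

/-! ### The conditional success of Thm. 5.9 at the `PMF` level -/

namespace Literature.Algebra.EuclideanLattices.MicciancioRegev2007

open Literature.Probability.Distributions
open scoped Real

variable {V : Type*} [NormedAddCommGroup V] [InnerProductSpace ℝ V] [FiniteDimensional ℝ V]
  [MeasurableSpace V] [BorelSpace V]
variable (Λ : Submodule ℤ V) [DiscreteTopology Λ] [IsZLattice ℝ Λ]
variable {m : ℕ}

/-- **MR07 Thm. 5.9, the Markov step, `PMF` form**: for `y ∼ ⨂ᵢ D_{Λ,s,c'ᵢ}` (`indepLaw`),
`s = 2r/(β√n)`, `2η_ε(Λ) ≤ s`, `∑ zᵢ² ≤ β²` and the side condition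
`1/(2π) + ε/(1−ε) + (ε/(1−ε))² m ≤ 1/6`: the mass of `{y | r < ‖∑ᵢ zᵢ (yᵢ − c'ᵢ)‖}` is `≤ 2/3`.
[cite: MicciancioRegev2007, Thm. 5.9 (proof, p. 24)] -/
theorem toReal_indepLaw_lt_norm_sum_smul_coe_sub_le {ε β r : ℝ} (hε : 0 < ε) (hε1 : ε < 1)
    (hβ : 0 < β) (hr : 0 < r) (hn : 1 ≤ finrank ℝ V)
    (hηs : 2 * smoothingParameter Λ ε ≤ 2 * r / (β * Real.sqrt (finrank ℝ V))) (c' : Fin m → V)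
    {z : Fin m → ℤ} (hz : ∑ i, (z i : ℝ) ^ 2 ≤ β ^ 2)
    (hnum : 1 / (2 * π) + ε / (1 - ε) + (ε / (1 - ε)) ^ 2 * m ≤ 1 / 6) :
    ((indepLaw m fun i => discreteGaussian Λ (2 * r / (β * Real.sqrt (finrank ℝ V))) (c' i)).toOuterMeasure
        {y | r < ‖∑ i, (z i : ℝ) • ((y i : V) - c' i)‖}).toReal ≤ 2 / 3 := by
  set p : Fin m → PMF Λ := fun i =>
    discreteGaussian Λ (2 * r / (β * Real.sqrt (finrank ℝ V))) (c' i) with hp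
  have h := measureReal_lt_norm_sum_smul_coe_sub_le Λ hε hε1 hβ hr hn hηs c'
    (iIndepFun_eval_indepLaw m p) (fun i => hasLaw_eval_indepLaw m p i) hz hnum
  rwa [measureReal_indepLaw_eq_toReal] at h

/-- **MR07 Thm. 5.9, conditional success probability `≥ 1/3`, `PMF` form** (pp. 23–24): for fixed
`C`, `A`, `z` with `H` (so `‖z‖ ≤ β`, `Tz = −t`), the `yᵢ` independent with laws `D_{Λ,s,cᵢ+tᵢ}`
(`indepLaw`, `s = 2r/(β√n)`), the combining output `x` with `‖x − Cz‖ ≤ b` (`= ‖S‖/g`) and the side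
condition: the output `s = x − Yz` satisfies `Pr[b + r < ‖s − t‖] ≤ 2/3`.
[cite: MicciancioRegev2007, Thm. 5.9 (proof, pp. 23–24)] -/
theorem toReal_indepLaw_lt_norm_output_sub_le {ε β r b : ℝ} (hε : 0 < ε) (hε1 : ε < 1)
    (hβ : 0 < β) (hr : 0 < r) (hn : 1 ≤ finrank ℝ V)
    (hηs : 2 * smoothingParameter Λ ε ≤ 2 * r / (β * Real.sqrt (finrank ℝ V))) (c tv : Fin m → V)
    {z : Fin m → ℤ} (hz : ∑ i, (z i : ℝ) ^ 2 ≤ β ^ 2)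
    (hnum : 1 / (2 * π) + ε / (1 - ε) + (ε / (1 - ε)) ^ 2 * m ≤ 1 / 6)
    {x t : V} (hx : ‖x - ∑ i, (z i : ℝ) • c i‖ ≤ b) (hT : ∑ i, (z i : ℝ) • tv i = -t) :
    ((indepLaw m fun i =>
        discreteGaussian Λ (2 * r / (β * Real.sqrt (finrank ℝ V))) (c i + tv i)).toOuterMeasure
        {y | b + r < ‖(x - ∑ i, (z i : ℝ) • (y i : V)) - t‖}).toReal ≤ 2 / 3 := by
  set p : Fin m → PMF Λ := fun i =>
    discreteGaussian Λ (2 * r / (β * Real.sqrt (finrank ℝ V))) (c i + tv i) with hp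
  have h := measureReal_lt_norm_output_sub_le Λ hε hε1 hβ hr hn hηs c tv
    (iIndepFun_eval_indepLaw m p) (fun i => hasLaw_eval_indepLaw m p i) hz hnum hx hT
  rwa [measureReal_indepLaw_eq_toReal] at h

end Literature.Algebra.EuclideanLattices.MicciancioRegev2007

end
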